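import Summits.QuantumFields.YangMills.Theorems.BalabanUVNodesN15KingModelGraphReplacementExtLines

/-!
# BalabanUVNodes ∕ N15 — THE KING-MODEL RUNG (PART Η-f): PROPOSITION 3.6's REPLACEMENT STEP WITH THE SOURCES — *«The sources g_{μν}(x′), h(x′) and the
# partition of unity function χ(x′) can be replaced by g_{μν}(x), h(x) and χ(x) respectively, since their derivatives are uniformly bounded»* (p. 665):
# a Lipschitz function of the position, sampled on `T_{η′}` and on `T_η`, differs under King's pairing by `≤ Lip·(d+1)·η` (`η = L^{−K}`); with King's `A = 0`
# slices on the internal lines, `|E^{(K+n)}(H(j)) − E^{(K)}(H(j))| ≤ L^{−γK}·Σ_ℓ 𝔼^{(K)}(H(j); ℓ lowered by γ) + η·(d+1)·Σ_υ Lip_υ·𝔼^{(K)}(H(j); υ ↦ 1)`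
# (Track A, DAG node N15 = NE2; FAN-OUT v1.1 §N15 s3 «KING-MODEL RUNG … NE2's analogue DECIDED in the model»)

HONEST FRAMING.  Count-neutral (cell `pub-ymgap`, seat `pub-ymgap-dag-n15-e` g25; `--supports stmt-QuantumFields-27366 --as helper` = K3⁸
`SpineGivenEndpointR13SepCoPHV`).  TEMPLATE LITERATURE: C. King, *The U(1) Higgs model. I. The continuum limit*, Commun. Math. Phys. **102** (1986) 649–677
[King1986], proof of Proposition 3.6, p. 665 [PDF 17] l. 5–7, verbatim: *«The sources g_{μν}(x′), h(x′) and the partition of unity function χ(x′) can be replaced by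
g_{μν}(x), h(x) and χ(x) respectively, since their derivatives are uniformly bounded.»* (the sources `g, h` of (2.24) p. 654 are `C^∞` functions on the torus;
χ of (3.36) p. 660 is `C^∞` with Σχ = 1); p. 664: *«When x′ ∈ T_{η′}, we denote by x that point in T_η for which x′ ∈ B^n(x).»*  MODEL LEVEL: a source is a
function of the POSITION `fineCoord x = x∕L^K ∈ ℝ^{d+1}` (unit-lattice units) with a Lipschitz constant; King's `A = 0` slices on the lines (part Η-c).  NOT
Bałaban's non-abelian `G(U)` of [B9]; NOT a node discharge; nothing continuum ∕ ℝ⁴ ∕ OS ∕ mass-gap ∕ Clay.  0 `sorry`; standard axioms.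

WHAT THIS FILE PROVES (namespace `Summit.QuantumFields.YangMills.BalabanUVNodes.N15KingModelRung.Curved`).
* §1 `fineCoord Nf M x = (x_μ∕Nf)_μ` (the position of a fine point in unit-lattice units); ★ `fineCoord_sub_kingSlicePt` — UNDER KING's PAIRING THE POSITIONS DIFFER
  BY LESS THAN `η`: `0 ≤ x′_μ∕L^{K+n} − x_μ∕L^K < L^{−K}` (`x = π x′`: the remainder of `x′_μ` mod `L^n`, over `L^{K+n}`); `sum_abs_fineCoord_sub_le`
  (`Σ_μ |·| ≤ (d+1)·L^{−K}`); ★ `source_rate` — a source `g` with `|g(u) − g(v)| ≤ Lip·Σ_μ|u_μ − v_μ|` satisfies `|g(x′∕L^{K+n}) − g(x∕L^K)| ≤ Lip·(d+1)·L^{−K}`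
  (*«since their derivatives are uniformly bounded»*).
* §2 ★★★ **`king_graph_replacement_sources`**: with part Η-c's `C, δ₀, γ` (one triple per Hölder exponent, uniform in `0 < m² ≤ m₀²`, the volume, `K`, `n ≥ 1`,
  the graph): for EVERY graph shape with King's `A = 0` slices `j_ℓ` (`j_ℓ + 1 ≤ K`) on the internal lines and SOURCES `g_υ` (sizes `|g_υ| ≤ G_υ`, Lipschitz
  constants `Lip_υ` in the ℓ¹ position distance) at the vertices `vtx υ`, sampled at `x′∕L^{K+n}` on `T_{η′}` and at `x∕L^K` on `T_η`:
  `|E^{(K+n)}(H(j)) − E^{(K)}(H(j))| ≤ L^{−γK}·Σ_ℓ 𝔼^{(K)}_{C,δ₀}(H(j); ℓ lowered by γ; G) + L^{−K}·(d+1)·Σ_υ Lip_υ·𝔼^{(K)}_{C,δ₀}(H(j); G[υ ↦ 1])` — the sources'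
  share is FIRST ORDER in `η = L^{−K}`.
With parts Η-c (internal lines, Prop. 3.9), Η-d (dressings, (3.72)), Η-e (external lines, Prop. 3.8) this file completes the list of factors King replaces on p. 665.

HONEST SCOPE.  (a) Model level; positions in unit-lattice units read from the torus labels `0 ≤ x_μ < L^K·M_μ` (no wrap-around metric is needed for the
pairing difference, which is a same-block quantity); Lipschitz in the ℓ¹ distance of positions (any `C¹` source qualifies with `Lip = sup|∇g|`).  (b) The
replacement step only; no power counting.  (c) NOT Bałaban's `G(U)`; NE2 not touched; N15's booking unchanged; counts unmoved.
Locators: [King1986] (2.24) p.654 (sources), (3.36) p.660 (χ), Prop. 3.6 p.662, p.664 (pairing), p.665 l.5–7.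
-/

noncomputable section

namespace Summit.QuantumFields.YangMills.BalabanUVNodes.N15KingModelRung.Curved

open scoped BigOperators
open Finset
open Literature.MathematicalPhysics.QuantumFieldTheory.Balaban1983to89.B5Prop11Plancherel (Tor fine)
open Literature.MathematicalPhysics.QuantumFieldTheory.King1986.Torus (tdistT)
open Literature.MathematicalPhysics.QuantumFieldTheory.King1986.SlicePropagator (Prop37PrintedAt Prop39PrintedAt)
open Summit.QuantumFields.YangMills.BalabanUVNodes.N15KingModelRung (KingVolIndex kingVol kingVol_neZero)
open Summit.QuantumFields.YangMills.BalabanUVNodes.N15KingModelRung.Graph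

variable {d : ℕ} (L : ℕ) [NeZero L]

/-! ## §1 Positions under King's pairing differ by less than `η` -/

section Coord

/-- **THE POSITION OF A FINE POINT IN UNIT-LATTICE UNITS**: `x_μ∕Nf` (`Nf = L^K` fine points per unit length; the torus label `0 ≤ x_μ < Nf·M_μ`).
[cite: King1986, (2.10) p.653, p.664 (pairing)] -/
def fineCoord (Nf : ℕ) (M : Fin (d + 1) → ℕ) (x : Tor (fine Nf M)) : Fin (d + 1) → ℝ := fun μ => ((x μ).val : ℝ) / Nf

omit [NeZero L] in
/-- reading. [cite: King1986, (2.10) p.653] -/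
theorem fineCoord_apply (Nf : ℕ) (M : Fin (d + 1) → ℕ) (x : Tor (fine Nf M)) (μ : Fin (d + 1)) :
    fineCoord Nf M x μ = ((x μ).val : ℝ) / Nf := rfl

/-- ★ **UNDER KING's PAIRING THE POSITIONS DIFFER BY LESS THAN `η = L^{−K}`**: for `x = π x′` (`x_μ = ⌊x′_μ∕L^n⌋`),
`0 ≤ x′_μ∕L^{K+n} − x_μ∕L^K < L^{−K}` — the difference is the remainder of `x′_μ` modulo `L^n`, divided by `L^{K+n}` (`x′ ∈ B^n(x)`).
[cite: King1986, p.664 («we denote by x that point in T_η for which x′ ∈ B^n(x)»)] -/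
theorem fineCoord_sub_kingSlicePt (K n : ℕ) (M : Fin (d + 1) → ℕ) [∀ μ, NeZero (M μ)] (x' : Tor (fine (L ^ (K + n)) M)) (μ : Fin (d + 1)) :
    0 ≤ fineCoord (L ^ (K + n)) M x' μ - fineCoord (L ^ K) M (kingSlicePt L K n M x') μ ∧
    fineCoord (L ^ (K + n)) M x' μ - fineCoord (L ^ K) M (kingSlicePt L K n M x') μ < ((L : ℝ) ^ K)⁻¹ := by
  have hL0 : (0 : ℝ) < L := by exact_mod_cast Nat.pos_of_ne_zero (NeZero.ne L)
  have hKp : (0 : ℝ) < (L : ℝ) ^ K := pow_pos hL0 _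
  have hnp : (0 : ℝ) < (L : ℝ) ^ n := pow_pos hL0 _
  have hnN : 0 < L ^ n := pow_pos (Nat.pos_of_ne_zero (NeZero.ne L)) _
  set v : ℕ := (x' μ).val with hv
  have hq : (kingSlicePt L K n M x' μ).val = v / L ^ n := val_kingSlicePt L K n M x' μ
  -- `v = L^n·q + r`, `0 ≤ r < L^n`
  have hdm : (L ^ n : ℕ) * (v / L ^ n) + v % L ^ n = v := Nat.div_add_mod v (L ^ n)
  have hr : v % L ^ n < L ^ n := Nat.mod_lt v hnN
  have hdiff : fineCoord (L ^ (K + n)) M x' μ - fineCoord (L ^ K) M (kingSlicePt L K n M x') μ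
      = ((v % L ^ n : ℕ) : ℝ) / ((L : ℝ) ^ K * (L : ℝ) ^ n) := by
    rw [fineCoord_apply, fineCoord_apply, hq, ← hv]
    have hcast : ((v : ℕ) : ℝ) = ((L : ℝ) ^ n) * (((v / L ^ n : ℕ) : ℝ)) + ((v % L ^ n : ℕ) : ℝ) := by
      have := congrArg (fun t : ℕ => (t : ℝ)) hdm
      push_cast at this ⊢
      linarith
    rw [hcast]
    push_cast
    rw [pow_add]
    field_simp
    ring
  rw [hdiff]
  refine ⟨div_nonneg (Nat.cast_nonneg _) (by positivity), ?_⟩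
  rw [div_lt_iff₀ (by positivity)]
  have hr' : ((v % L ^ n : ℕ) : ℝ) < (L : ℝ) ^ n := by exact_mod_cast hr
  calc ((v % L ^ n : ℕ) : ℝ) < (L : ℝ) ^ n := hr'
    _ = ((L : ℝ) ^ K)⁻¹ * ((L : ℝ) ^ K * (L : ℝ) ^ n) := by field_simp

/-- **summed over the directions**: `Σ_μ |x′_μ∕L^{K+n} − x_μ∕L^K| ≤ (d+1)·L^{−K}`. [cite: King1986, p.664 (pairing)] -/
theorem sum_abs_fineCoord_sub_le (K n : ℕ) (M : Fin (d + 1) → ℕ) [∀ μ, NeZero (M μ)] (x' : Tor (fine (L ^ (K + n)) M)) :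
    ∑ μ, |fineCoord (L ^ (K + n)) M x' μ - fineCoord (L ^ K) M (kingSlicePt L K n M x') μ| ≤ ((d : ℝ) + 1) * ((L : ℝ) ^ K)⁻¹ := by
  calc ∑ μ, |fineCoord (L ^ (K + n)) M x' μ - fineCoord (L ^ K) M (kingSlicePt L K n M x') μ|
      ≤ ∑ _μ : Fin (d + 1), ((L : ℝ) ^ K)⁻¹ := sum_le_sum fun μ _ => by
        obtain ⟨h0, hlt⟩ := fineCoord_sub_kingSlicePt L K n M x' μ
        rw [abs_of_nonneg h0]
        exact hlt.le
    _ = ((d : ℝ) + 1) * ((L : ℝ) ^ K)⁻¹ := by rw [sum_const, card_univ, Fintype.card_fin, nsmul_eq_mul]; push_cast; ring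

/-- ★ **«… SINCE THEIR DERIVATIVES ARE UNIFORMLY BOUNDED»**: a source `g` of the position with `|g(u) − g(v)| ≤ Lip·Σ_μ|u_μ − v_μ|` sampled on the two
lattices differs under the pairing by `|g(x′∕L^{K+n}) − g(x∕L^K)| ≤ Lip·(d+1)·L^{−K}` — first order in `η`. [cite: King1986, p.665 l.5–7] -/
theorem source_rate (K n : ℕ) (M : Fin (d + 1) → ℕ) [∀ μ, NeZero (M μ)] {g : (Fin (d + 1) → ℝ) → ℝ} {Lip : ℝ} (hLip0 : 0 ≤ Lip)
    (hLip : ∀ u v, |g u - g v| ≤ Lip * ∑ μ, |u μ - v μ|) (x' : Tor (fine (L ^ (K + n)) M)) :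
    ‖g (fineCoord (L ^ (K + n)) M x') - g (fineCoord (L ^ K) M (kingSlicePt L K n M x'))‖ ≤ Lip * (((d : ℝ) + 1) * ((L : ℝ) ^ K)⁻¹) := by
  rw [Real.norm_eq_abs]
  exact (hLip _ _).trans (mul_le_mul_of_nonneg_left (sum_abs_fineCoord_sub_le L K n M x') hLip0)

end Coord

/-! ## §2 The replacement step with sources at the vertices, BY NAME at `A = 0` -/

section ByName

/-- ★★★ **PROPOSITION 3.6's REPLACEMENT STEP WITH SOURCES, BY NAME AT `A = 0`.**  With part Η-c's constants (one `(C, δ₀, γ)` per Hölder exponent, uniform in the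
mass `0 < m² ≤ m₀²`, the volume, `K ≥ 1`, `n ≥ 1` and the graph): for every graph shape whose internal lines carry King's `A = 0` slices `j_ℓ` (`j_ℓ + 1 ≤ K`) and
whose vertices `vtx υ` carry SOURCES `g_υ` of the position (`|g_υ| ≤ G_υ`, `|g_υ(u) − g_υ(v)| ≤ Lip_υ·Σ_μ|u_μ − v_μ|`), sampled at `x′∕L^{K+n}` resp. `x∕L^K`:
`|E^{(K+n)}(H(j)) − E^{(K)}(H(j))| ≤ L^{−γK}·Σ_ℓ 𝔼^{(K)}_{C,δ₀}(H(j); ℓ at the exponent lowered by γ; G) + Σ_υ Lip_υ·(d+1)·L^{−K}·𝔼^{(K)}_{C,δ₀}(H(j); G[υ ↦ 1])`.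
ASSEMBLY: Ω₂ `king_props37_38_39_commonConstants` + Η-c (fibres, weights, fine slice sizes) + §1 `source_rate` on part Η-b `graph_replacement_twoSpacing`.
[cite: King1986, p.665 l.5–7 («The sources … can be replaced … since their derivatives are uniformly bounded»), pp.664–665 (proof of Prop. 3.6)] -/
theorem king_graph_replacement_sources (hLodd : Odd L) (hL : 2 ≤ L) {a : ℝ} (ha : 0 < a) {m0sq : ℝ} (hm0 : 0 ≤ m0sq)
    {α : ℝ} (hα0 : 0 < α) (hα1 : α < 1) :
    ∃ C δ₀ γ : ℝ, 0 < C ∧ 0 < δ₀ ∧ 0 < γ ∧ ∀ (msq : ℝ), 0 < msq → msq ≤ m0sq → ∀ (j : KingVolIndex d) (n : ℕ), 1 ≤ n →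
      ∀ (V Λ Υ : Type) [Fintype V] [DecidableEq V] [Fintype Λ] [DecidableEq Λ] [Fintype Υ] [DecidableEq Υ]
        (src tgt : Λ → V) (js : Λ → ℕ), (∀ ℓ, js ℓ + 1 ≤ j.K) → ∀ (κ : Λ → Option (Fin (d + 1))) (vtx : Υ → V)
        (g : Υ → (Fin (d + 1) → ℝ) → ℝ) (G Lip : Υ → ℝ), (∀ υ u, |g υ u| ≤ G υ) → (∀ υ, 0 ≤ Lip υ) →
        (∀ υ u v, |g υ u - g υ v| ≤ Lip υ * ∑ μ, |u μ - v μ|) →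
        haveI := kingVol_neZero L j
        ‖graphValLS ((((L : ℝ) ^ (j.K + n))⁻¹) ^ (d + 1)) src tgt (fun ℓ => kingHiLine L a msq j n (js ℓ) (κ ℓ)) vtx
              (fun υ x' => g υ (fineCoord (L ^ (j.K + n)) (kingVol L j) x'))
            - graphValLS ((((L : ℝ) ^ j.K)⁻¹) ^ (d + 1)) src tgt (fun ℓ => kingLoLine L a msq j n (js ℓ) (κ ℓ)) vtx
              (fun υ x => g υ (fineCoord (L ^ j.K) (kingVol L j) x))‖
          ≤ (L : ℝ) ^ (-(γ * j.K))
              * ∑ ℓ, graphValLS ((((L : ℝ) ^ j.K)⁻¹) ^ (d + 1)) src tgt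
                  (Function.update (fun ℓ => kingSizeProfile L a msq j n C δ₀ (js ℓ) (κ ℓ)) ℓ (kingReducedProfile L a msq j n C δ₀ γ (js ℓ) (κ ℓ))) vtx
                  (fun υ _ => G υ)
            + ∑ υ, (Lip υ * (((d : ℝ) + 1) * ((L : ℝ) ^ j.K)⁻¹))
                * graphValLS ((((L : ℝ) ^ j.K)⁻¹) ^ (d + 1)) src tgt (fun ℓ => kingSizeProfile L a msq j n C δ₀ (js ℓ) (κ ℓ)) vtx
                  (Function.update (fun υ _ => G υ) υ (fun _ => (1 : ℝ))) := by
  obtain ⟨C, δ₀, γ, hC, hδ₀, hγ, H⟩ := king_props37_38_39_commonConstants (d := d) L hLodd hL ha hm0 hα0 hα1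
  have hL1 : 1 ≤ L := by omega
  have hL0 : (0 : ℝ) < L := by exact_mod_cast (show 0 < L by omega)
  refine ⟨C * Real.exp δ₀, δ₀, γ, by positivity, hδ₀, hγ,
    fun msq hm hcap j n hn V Λ Υ _ _ _ _ _ _ src tgt js hjs κ vtx g G Lip hG hLip0 hLip => ?_⟩
  haveI := kingVol_neZero L j
  obtain ⟨h37, h37', -, h39⟩ := H msq hm hcap j n hn
  letI : Fintype (kingTwoSpacingFull L a msq j n).lo.S := inferInstanceAs (Fintype (Tor (fine (L ^ j.K) (kingVol L j))))
  letI : DecidableEq (kingTwoSpacingFull L a msq j n).lo.S := inferInstanceAs (DecidableEq (Tor (fine (L ^ j.K) (kingVol L j))))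
  letI : Fintype (kingTwoSpacingFull L a msq j n).hi.S := inferInstanceAs (Fintype (Tor (fine (L ^ (j.K + n)) (kingVol L j))))
  have hCe : C ≤ C * Real.exp δ₀ := le_mul_of_one_le_right hC.le (Real.one_le_exp hδ₀.le)
  have h37e : Prop37PrintedAt α (kingTwoSpacingFull L a msq j n).lo (C * Real.exp δ₀) δ₀ :=
    prop37PrintedAt_mono (D := (kingTwoSpacingFull L a msq j n).lo) hL1 (kingTwoSpacingFull_lodist_nonneg L a msq j n)
      (fun _ _ b => nomatch b) hC.le hCe le_rfl h37
  have h39e : Prop39PrintedAt α (kingTwoSpacingFull L a msq j n) (C * Real.exp δ₀) δ₀ γ :=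
    prop39PrintedAt_mono (T := kingTwoSpacingFull L a msq j n) hL1 (kingTwoSpacingFull_lodist_nonneg L a msq j n)
      (fun _ _ b => nomatch b) hC.le hCe le_rfl le_rfl h39
  have hhi : ∀ jl : ℕ, jl + 1 ≤ (kingTwoSpacingFull L a msq j n).lo.k →
      ∀ (κ : Option (Fin (d + 1))) (x' y' : (kingTwoSpacingFull L a msq j n).hi.S),
      ‖hiLine (kingTwoSpacingFull L a msq j n) jl κ x' y'‖
        ≤ sizeProfile (kingTwoSpacingFull L a msq j n) (C * Real.exp δ₀) δ₀ jl κ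
          ((kingTwoSpacingFull L a msq j n).pt x') ((kingTwoSpacingFull L a msq j n).pt y') :=
    fun jl hjl κ x' y' => hiLine_kingTwoSpacingFull_le L hL a msq j n hC.le hδ₀.le h37' hjl κ x' y'
  have hfib : ∀ x : (kingTwoSpacingFull L a msq j n).lo.S,
      (univ.filter fun x' : (kingTwoSpacingFull L a msq j n).hi.S => (kingTwoSpacingFull L a msq j n).pt x' = x).card = (L ^ n) ^ (d + 1) :=
    fun x => card_filter_kingSlicePt L j.K n (kingVol L j) x
  have hw := king_weight_repair (d := d) L hL0 j.K n
  have hp : ∀ υ (x : Tor (fine (L ^ j.K) (kingVol L j))), ‖g υ (fineCoord (L ^ j.K) (kingVol L j) x)‖ ≤ G υ :=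
    fun υ x => by rw [Real.norm_eq_abs]; exact hG υ _
  have hp' : ∀ υ (x' : Tor (fine (L ^ (j.K + n)) (kingVol L j))), ‖g υ (fineCoord (L ^ (j.K + n)) (kingVol L j) x')‖ ≤ G υ :=
    fun υ x' => by rw [Real.norm_eq_abs]; exact hG υ _
  have hq : ∀ υ (x' : Tor (fine (L ^ (j.K + n)) (kingVol L j))),
      ‖g υ (fineCoord (L ^ (j.K + n)) (kingVol L j) x') - g υ (fineCoord (L ^ j.K) (kingVol L j) (kingSlicePt L j.K n (kingVol L j) x'))‖
        ≤ Lip υ * (((d : ℝ) + 1) * ((L : ℝ) ^ j.K)⁻¹) * 1 :=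
    fun υ x' => by rw [mul_one]; exact source_rate L j.K n (kingVol L j) (hLip0 υ) (hLip υ) x'
  have h := graph_replacement_twoSpacing (kingTwoSpacingFull L a msq j n) h37e hhi h39e hfib hw src tgt js hjs κ vtx
    (fun υ x => g υ (fineCoord (L ^ j.K) (kingVol L j) x)) (fun υ x' => g υ (fineCoord (L ^ (j.K + n)) (kingVol L j) x'))
    (fun υ _ => G υ) (fun υ _ => Lip υ * (((d : ℝ) + 1) * ((L : ℝ) ^ j.K)⁻¹) * 1) hp hp' hq
  have hnorm : ‖(((L : ℝ) ^ j.K)⁻¹) ^ (d + 1)‖ = (((L : ℝ) ^ j.K)⁻¹) ^ (d + 1) := Real.norm_of_nonneg (by positivity)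
  rw [hnorm] at h
  refine h.trans (le_of_eq ?_)
  congr 1
  · rw [mul_sum]
    refine sum_congr rfl fun ℓ _ => ?_
    have hr : rateProfile (kingTwoSpacingFull L a msq j n) (C * Real.exp δ₀) δ₀ γ (js ℓ) (κ ℓ)
        = fun x y => (L : ℝ) ^ (-(γ * j.K)) * reducedProfile (kingTwoSpacingFull L a msq j n) (C * Real.exp δ₀) δ₀ γ (js ℓ) (κ ℓ) x y :=
      funext fun x => funext fun y => rateProfile_eq (kingTwoSpacingFull L a msq j n) (C * Real.exp δ₀) δ₀ γ (js ℓ) (κ ℓ) x y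
    show graphValLS _ src tgt (Function.update (fun ℓ => sizeProfile (kingTwoSpacingFull L a msq j n) (C * Real.exp δ₀) δ₀ (js ℓ) (κ ℓ)) ℓ
        (rateProfile (kingTwoSpacingFull L a msq j n) (C * Real.exp δ₀) δ₀ γ (js ℓ) (κ ℓ))) vtx _ = _
    rw [hr, graphValLS_line_update_mul]
    rfl
  · refine sum_congr rfl fun υ _ => ?_
    rw [graphValLS_site_update_mul]
    rfl

end ByName

end Summit.QuantumFields.YangMills.BalabanUVNodes.N15KingModelRung.Curved

end
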